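import Summits.AtomisticToContinuum.Crystallization.Theorems.FrustratedLawDichotomyStrainedPatchHomValueT2SlopeSoundA

/-!
# (I1) slope part E — ★★ THE PER-LABEL SECOND-ORDER FORCE ENCLOSURE along the joint segment for a LIPSCHITZ-CLASS label (`…HomValueT2Track` §14b,
# the remainder `rp`; critic row 1674 (B) (I1) docket item 3 `slopeT2_sound`, fifth instalment; 27623 `(H) HomFloor`, hcp half; decomp-a2c hand-1 g49)

One label with argument path `q + tΔξ` under the frame path `V + tΔU` (`ΔU` symmetric; `δ = dispN ΔU Δξ` vanishing from `top` on), recorded on the full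
box (`Rb`) with `Rb.co.lip = true` (the `ρ`-range of the box inside ONE open regime).  Then each component of the label's `y`-space force satisfies
`|β y_a(1) − β y_a(0) − Σ_{k<top} dF^ℝ_k(0) δ_k| ≤ ½ Σ_{k,l<top} |ddF Rb a k l|↑/SC · |δ_k||δ_l|` (part A `hasDerivAt_force_label`, `hasDerivAt_dforce_label`,
`abs_sub_sub_le_of_deriv2_off`; `…SoundN.coefL_lip`, `mem_pt_rt`).  No definitions; 0 sorry; standard axioms.  `--supports stmt-AtomisticToContinuum-27623`.
-/

noncomputable section

namespace Summit.AtomisticToContinuum.Crystallization.Theorems.FrustratedLawDichotomyStrainedPatchHomValueT2Kit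

open scoped BigOperators RealInnerProductSpace
open Finset
open Literature.Analysis.ValidatedNumerics.Numerics
open Summit.AtomisticToContinuum.Crystallization.Theorems.ChargedEnergyGapNegative (E3)
open Summit.AtomisticToContinuum.Crystallization.Theorems.FrustratedLawDichotomySchurCut (effPot w₄₅ ω₄)
open Summit.AtomisticToContinuum.Crystallization.Theorems.FrustratedLawDichotomyStrainedPatchTaylorLeaves (junctions)
open Summit.AtomisticToContinuum.Crystallization.Theorems.FrustratedLawDichotomyStrainedPatchHomEntryGramHcp (dot3 mem_dot3)
open Summit.AtomisticToContinuum.Crystallization.Theorems.FrustratedLawDichotomyStrainedPatchHomCurvCoeff3 (abs_le_of_mem)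

/-- ★★ **PER-LABEL SECOND-ORDER FORCE ENCLOSURE (Lipschitz class).** [folklore chaining] -/
theorem force_label_taylor2 (V ΔU : E3 →L[ℝ] E3) (q Δξ : E3) (hsym : ∀ a b : Fin 3, ent ΔU a b = ent ΔU b a) {top : ℕ} (htop : top ≤ 9)
    (hδ : ∀ k, top ≤ k → k < 9 → dispN ΔU Δξ k = 0) {EF : Fin 3 × Fin 3 → FI} {qF : Fin 3 → FI} {Rb : DRec} (hRb : mkDRec top EF qF = some Rb)
    (hEF : ∀ t ∈ Set.Icc (0 : ℝ) 1, ∀ ab : Fin 3 × Fin 3, FI.mem (((V + t • ΔU) (EuclideanSpace.single ab.2 (1 : ℝ))) ab.1) (EF ab))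
    (hqF : ∀ t ∈ Set.Icc (0 : ℝ) 1, ∀ c, FI.mem ((q + t • Δξ) c) (qF c)) (hlip : Rb.co.lip = true) (a : Fin 3) :
    |deriv (effPot w₄₅ ω₄ (3 / 400)) ‖(V + ΔU) (q + Δξ)‖ / ‖(V + ΔU) (q + Δξ)‖ * ((V + ΔU) (q + Δξ)) a - deriv (effPot w₄₅ ω₄ (3 / 400)) ‖V q‖ / ‖V q‖ * (V q) a -
        ∑ k ∈ range top, ((deriv (deriv (effPot w₄₅ ω₄ (3 / 400))) ‖V q‖ - deriv (effPot w₄₅ ω₄ (3 / 400)) ‖V q‖ / ‖V q‖) / ‖V q‖ ^ 2 * (zetaN V q k * (V q) a) + deriv (effPot w₄₅ ω₄ (3 / 400)) ‖V q‖ / ‖V q‖ * dyR V q k a) * dispN ΔU Δξ k| ≤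
      1 / 2 * ∑ k ∈ range top, ∑ l ∈ range top, (((ddF Rb a k l).absHi : ℤ) : ℝ) / SC * (|dispN ΔU Δξ k| * |dispN ΔU Δξ l|) := by
  have hS := SC_pos
  have hpos : ∀ t ∈ Set.Icc (0 : ℝ) 1, 0 < ‖(V + t • ΔU) (q + t • Δξ)‖ := fun t ht => norm_pos_of_mkDRec hRb _ _ (hEF t ht) (hqF t ht)
  have hcoF := mkDRec_coefL hRb
  have hQF : ∀ t ∈ Set.Icc (0 : ℝ) 1, FI.mem (‖(V + t • ΔU) (q + t • Δξ)‖ ^ 2) (dot3 (tab3 (yOf EF (tab3 qF))) (tab3 (yOf EF (tab3 qF)))) :=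
    fun t ht => mem_labelQ _ _ (hEF t ht) (hqF t ht)
  have e0V : V + (0 : ℝ) • ΔU = V := by ext x; simp
  have e0q : q + (0 : ℝ) • Δξ = q := by rw [zero_smul, add_zero]
  have e1V : V + (1 : ℝ) • ΔU = V + ΔU := by ext x; simp
  have e1q : q + (1 : ℝ) • Δξ = q + Δξ := by rw [one_smul]
  -- (1) first derivative on `[0,1]` (a Lipschitz-class label never meets a junction radius)
  have hg : ∀ t ∈ Set.Icc (0 : ℝ) 1, HasDerivAt (fun t : ℝ => deriv (effPot w₄₅ ω₄ (3 / 400)) ‖(V + t • ΔU) (q + t • Δξ)‖ / ‖(V + t • ΔU) (q + t • Δξ)‖ * ((V + t • ΔU) (q + t • Δξ)) a) ((fun t : ℝ => ∑ k ∈ range 9, ((deriv (deriv (effPot w₄₅ ω₄ (3 / 400))) ‖(V + t • ΔU) (q + t • Δξ)‖ - deriv (effPot w₄₅ ω₄ (3 / 400)) ‖(V + t • ΔU) (q + t • Δξ)‖ / ‖(V + t • ΔU) (q + t • Δξ)‖) / ‖(V + t • ΔU) (q + t • Δξ)‖ ^ 2 * (zetaN (V + t • ΔU) (q + t • Δξ)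 k * ((V + t • ΔU) (q + t • Δξ)) a) + deriv (effPot w₄₅ ω₄ (3 / 400)) ‖(V + t • ΔU) (q + t • Δξ)‖ / ‖(V + t • ΔU) (q + t • Δξ)‖ * dyR (V + t • ΔU) (q + t • Δξ) k a) * dispN ΔU Δξ k) t) t := fun t ht =>
    hasDerivAt_force_label V ΔU q Δξ hsym (hpos t ht) (coefL_lip (hpos t ht) (hQF t ht) hcoF hlip).2.1 a
  -- (2) second derivative on `[0,1]`, with the `t`-dependent `a₁`, and the entrywise memberships in `ddF`
  have hQd : ∀ t ∈ Set.Icc (0 : ℝ) 1, ∃ a₁ : ℝ,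
      HasDerivAt (fun t : ℝ => ∑ k ∈ range 9, ((deriv (deriv (effPot w₄₅ ω₄ (3 / 400))) ‖(V + t • ΔU) (q + t • Δξ)‖ - deriv (effPot w₄₅ ω₄ (3 / 400)) ‖(V + t • ΔU) (q + t • Δξ)‖ / ‖(V + t • ΔU) (q + t • Δξ)‖) / ‖(V + t • ΔU) (q + t • Δξ)‖ ^ 2 * (zetaN (V + t • ΔU) (q + t • Δξ) k * ((V + t • ΔU) (q + t • Δξ)) a) + deriv (effPot w₄₅ ω₄ (3 / 400)) ‖(V + t • ΔU) (q + t • Δξ)‖ / ‖(V + t • ΔU) (q + t • Δξ)‖ * dyR (V + t • ΔU) (q + t • Δξ) k a) * dispN ΔU Δξ k) (∑ k ∈ range 9, (∑ m ∈ range 9, ((a₁ * (zetaN (V + t • ΔU) (q + t • Δξ) k * zetaN (V + t • ΔU) (q + t • Δξ) m) + (deriv (deriv (effPot w₄₅ ω₄ (3 / 400))) ‖(V + t • ΔU) (q + t • Δξ)‖ - deriv (effPot w₄₅ ω₄ (3 / 400)) ‖(V + t • ΔU) (q + t • Δξ)‖ / ‖(V + t • ΔU) (q + t • Δξ)‖)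 / ‖(V + t • ΔU) (q + t • Δξ)‖ ^ 2 * nuR (V + t • ΔU) (q + t • Δξ) k m) * ((V + t • ΔU) (q + t • Δξ)) a + (deriv (deriv (effPot w₄₅ ω₄ (3 / 400))) ‖(V + t • ΔU) (q + t • Δξ)‖ - deriv (effPot w₄₅ ω₄ (3 / 400)) ‖(V + t • ΔU) (q + t • Δξ)‖ / ‖(V + t • ΔU) (q + t • Δξ)‖) / ‖(V + t • ΔU) (q + t • Δξ)‖ ^ 2 * (zetaN (V + t • ΔU) (q + t • Δξ) k * dyR (V + t • ΔU) (q + t • Δξ) m a + zetaN (V + t • ΔU) (q + t • Δξ) m * dyR (V + t • ΔU) (q + t • Δξ) k a) + deriv (effPot w₄₅ ω₄ (3 / 400)) ‖(V + t • ΔU) (q + t • Δξ)‖ / ‖(V + t • ΔU) (q + t • Δξ)‖ * ddyR k m a) * dispN ΔU Δξ m) * dispN ΔU Δξ k) t ∧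
      ∀ k m, k < top → m < top → FI.mem ((a₁ * (zetaN (V + t • ΔU) (q + t • Δξ) k * zetaN (V + t • ΔU) (q + t • Δξ) m) + (deriv (deriv (effPot w₄₅ ω₄ (3 / 400))) ‖(V + t • ΔU) (q + t • Δξ)‖ - deriv (effPot w₄₅ ω₄ (3 / 400)) ‖(V + t • ΔU) (q + t • Δξ)‖ / ‖(V + t • ΔU) (q + t • Δξ)‖) / ‖(V + t • ΔU) (q + t • Δξ)‖ ^ 2 * nuR (V + t • ΔU) (q + t • Δξ) k m) * ((V + t • ΔU) (q + t • Δξ)) a + (deriv (deriv (effPot w₄₅ ω₄ (3 / 400))) ‖(V + t • ΔU) (q + t • Δξ)‖ - deriv (effPot w₄₅ ω₄ (3 / 400)) ‖(V + t • ΔU) (q + t • Δξ)‖ / ‖(V + t • ΔU) (q + t • Δξ)‖) / ‖(V + t • ΔU) (q + t • Δξ)‖ ^ 2 * (zetaN (V + t • ΔU) (q + t • Δξ) k * dyR (V + t • ΔU) (q + t • Δξ) m a + zetaN (V + t • ΔU) (q + t • Δξ) m * dyR (V + t • ΔU) (q + t • Δξ) k a) + deriv (effPot w₄₅ ω₄ (3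 / 400)) ‖(V + t • ΔU) (q + t • Δξ)‖ / ‖(V + t • ΔU) (q + t • Δξ)‖ * ddyR k m a) (ddF Rb a k m) := by
    intro t ht
    obtain ⟨_, _, mal, mbe, ⟨a₁, ma1, hαd⟩, hβd⟩ := coefL_lip (hpos t ht) (hQF t ht) hcoF hlip
    obtain ⟨_, _, hζ, hν⟩ := mem_mkDRec htop hRb (V + t • ΔU) (q + t • Δξ) (hEF t ht) (hqF t ht)
    refine ⟨a₁, HasDerivAt.fun_sum fun k hk => (hasDerivAt_dforce_label V ΔU q Δξ hsym (Finset.mem_range.1 hk) (hpos t ht) hαd hβd a).mul_const _,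
      fun k m hk hm => ?_⟩
    exact mem_ddF htop hRb (V + t • ΔU) (q + t • Δξ) (hEF t ht) (hqF t ht) mal mbe a hk hm
      (mem_pt_rt htop hRb ma1 mal hζ hν (nuR_symm _ _) hk hm).1
  have hg'c : ContinuousOn (fun t : ℝ => ∑ k ∈ range 9, ((deriv (deriv (effPot w₄₅ ω₄ (3 / 400))) ‖(V + t • ΔU) (q + t • Δξ)‖ - deriv (effPot w₄₅ ω₄ (3 / 400)) ‖(V + t • ΔU) (q + t • Δξ)‖ / ‖(V + t • ΔU) (q + t • Δξ)‖) / ‖(V + t • ΔU) (q + t • Δξ)‖ ^ 2 * (zetaN (V + t • ΔU) (q + t • Δξ) k * ((V + t • ΔU) (q + t • Δξ)) a) + deriv (effPot w₄₅ ω₄ (3 / 400)) ‖(V + t • ΔU) (q + t • Δξ)‖ / ‖(V + t • ΔU) (q + t • Δξ)‖ * dyR (V + t • ΔU) (q + t • Δξ) k a) * dispN ΔU Δξ k) (Set.Icc 0 1) := fun t ht => by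
    obtain ⟨a₁, hd, _⟩ := hQd t ht
    exact hd.continuousAt.continuousWithinAt
  have hg'' : ∀ t ∈ Set.Ioo (0 : ℝ) 1, t ∉ (∅ : Finset ℝ) → HasDerivAt (fun t : ℝ => ∑ k ∈ range 9, ((deriv (deriv (effPot w₄₅ ω₄ (3 / 400))) ‖(V + t • ΔU) (q + t • Δξ)‖ - deriv (effPot w₄₅ ω₄ (3 / 400)) ‖(V + t • ΔU) (q + t • Δξ)‖ / ‖(V + t • ΔU) (q + t • Δξ)‖) / ‖(V + t • ΔU) (q + t • Δξ)‖ ^ 2 * (zetaN (V + t • ΔU) (q + t • Δξ) k * ((V + t • ΔU) (q + t • Δξ)) a) + deriv (effPot w₄₅ ω₄ (3 / 400)) ‖(V + t • ΔU) (q + t • Δξ)‖ / ‖(V + t • ΔU) (q + t • Δξ)‖ * dyR (V + t • ΔU) (q + t • Δξ) k a) * dispN ΔU Δξ k) (deriv (fun t : ℝ => ∑ k ∈ range 9, ((deriv (deriv (effPot w₄₅ ω₄ (3 / 400))) ‖(V + t • ΔU) (q + t • Δξ)‖ - deriv (effPot w₄₅ ω₄ (3 / 400)) ‖(V + t • ΔU)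 (q + t • Δξ)‖ / ‖(V + t • ΔU) (q + t • Δξ)‖) / ‖(V + t • ΔU) (q + t • Δξ)‖ ^ 2 * (zetaN (V + t • ΔU) (q + t • Δξ) k * ((V + t • ΔU) (q + t • Δξ)) a) + deriv (effPot w₄₅ ω₄ (3 / 400)) ‖(V + t • ΔU) (q + t • Δξ)‖ / ‖(V + t • ΔU) (q + t • Δξ)‖ * dyR (V + t • ΔU) (q + t • Δξ) k a) * dispN ΔU Δξ k) t) t := fun t ht _ => by
    obtain ⟨a₁, hd, _⟩ := hQd t (Set.Ioo_subset_Icc_self ht)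
    exact hd.differentiableAt.hasDerivAt
  -- (3) the bound of the second derivative
  have hM : ∀ t ∈ Set.Ioo (0 : ℝ) 1, t ∉ (∅ : Finset ℝ) → |deriv (fun t : ℝ => ∑ k ∈ range 9, ((deriv (deriv (effPot w₄₅ ω₄ (3 / 400))) ‖(V + t • ΔU) (q + t • Δξ)‖ - deriv (effPot w₄₅ ω₄ (3 / 400)) ‖(V + t • ΔU) (q + t • Δξ)‖ / ‖(V + t • ΔU) (q + t • Δξ)‖) / ‖(V + t • ΔU) (q + t • Δξ)‖ ^ 2 * (zetaN (V + t • ΔU) (q + t • Δξ) k * ((V + t • ΔU) (q + t • Δξ)) a) + deriv (effPot w₄₅ ω₄ (3 / 400)) ‖(V + t • ΔU) (q + t • Δξ)‖ / ‖(V + t • ΔU) (q + t • Δξ)‖ * dyR (V + t • ΔU) (q + t • Δξ) k a) * dispN ΔU Δξ k) t| ≤ ∑ k ∈ range top, ∑ l ∈ range top, (((ddF Rb a k l).absHi : ℤ) : ℝ) / SC * (|dispN ΔU Δξ k| * |dispN ΔU Δξ l|) := by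
    intro t ht _
    obtain ⟨a₁, hd, hmem⟩ := hQd t (Set.Ioo_subset_Icc_self ht)
    rw [hd.deriv, sum_range9_eq_sum_range htop hδ]
    refine (Finset.abs_sum_le_sum_abs _ _).trans (Finset.sum_le_sum fun k hk => ?_)
    have hk' := Finset.mem_range.1 hk
    rw [sum_range9_eq_sum_range htop hδ, abs_mul]
    have inner : |∑ m ∈ range top, ((a₁ * (zetaN (V + t • ΔU) (q + t • Δξ) k * zetaN (V + t • ΔU) (q + t • Δξ) m) + (deriv (deriv (effPot w₄₅ ω₄ (3 / 400))) ‖(V + t • ΔU) (q + t • Δξ)‖ - deriv (effPot w₄₅ ω₄ (3 / 400)) ‖(V + t • ΔU) (q + t • Δξ)‖ / ‖(V + t • ΔU) (q + t • Δξ)‖) / ‖(V + t • ΔU) (q + t • Δξ)‖ ^ 2 * nuR (V + t • ΔU) (q + t • Δξ) k m) * ((V + t • ΔU) (q + t • Δξ)) a + (deriv (deriv (effPot w₄₅ ω₄ (3 / 400))) ‖(V + t • ΔU) (q + t • Δξ)‖ - deriv (effPot w₄₅ ω₄ (3 / 400)) ‖(V + t • ΔU) (q + t • Δξ)‖ / ‖(V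 + t • ΔU) (q + t • Δξ)‖) / ‖(V + t • ΔU) (q + t • Δξ)‖ ^ 2 * (zetaN (V + t • ΔU) (q + t • Δξ) k * dyR (V + t • ΔU) (q + t • Δξ) m a + zetaN (V + t • ΔU) (q + t • Δξ) m * dyR (V + t • ΔU) (q + t • Δξ) k a) + deriv (effPot w₄₅ ω₄ (3 / 400)) ‖(V + t • ΔU) (q + t • Δξ)‖ / ‖(V + t • ΔU) (q + t • Δξ)‖ * ddyR k m a) * dispN ΔU Δξ m| ≤
        ∑ m ∈ range top, (((ddF Rb a k m).absHi : ℤ) : ℝ) / SC * |dispN ΔU Δξ m| :=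
      (Finset.abs_sum_le_sum_abs _ _).trans (Finset.sum_le_sum fun m hm => by
        rw [abs_mul]; exact mul_le_mul_of_nonneg_right (abs_le_of_mem (hmem k m hk' (Finset.mem_range.1 hm))) (abs_nonneg _))
    refine (mul_le_mul_of_nonneg_right inner (abs_nonneg _)).trans (le_of_eq ?_)
    rw [Finset.sum_mul]
    exact Finset.sum_congr rfl fun m _ => by ring
  have h := abs_sub_sub_le_of_deriv2_off (∅ : Finset ℝ) hg hg'c hg'' hM
  rw [e0V, e0q, e1V, e1q, sum_range9_eq_sum_range htop hδ] at h
  linarith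

end Summit.AtomisticToContinuum.Crystallization.Theorems.FrustratedLawDichotomyStrainedPatchHomValueT2Kit
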